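import Summits.NavierStokesRegularity.NavierStokesRegularity.Theorems.ScenarioCensusRowF1ax
import Summits.NavierStokesRegularity.NavierStokesRegularity.Theorems.ScenarioCensusRowA7h
import Summits.NavierStokesRegularity.NavierStokesRegularity.Theorems.DssFarFieldSlavingBlowupTypeIDssProfileSimilarityEnstrophyBeltramiLiouville
import Summits.NavierStokesRegularity.NavierStokesRegularity.Theorems.SqueezeCycleSingularZoomWindow
import Summits.NavierStokesRegularity.NavierStokesRegularity.Theorems.ClockStretchingLawClockCeilingZoomDerivLimit
import Summits.NavierStokesRegularity.NavierStokesRegularity.Theorems.PoloidalWindowDoorPoloidalWindowRigidityVorticityTranslate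
import Literature.Analysis.FluidPDE.TypeIAncientMild
import Literature.Analysis.FluidPDE.WholeSpaceIBP
import Literature.Analysis.FluidPDE.ClassicalSolutionCalculus
import Literature.Analysis.FluidPDE.VorticityEquation
import Literature.Analysis.FluidPDE.TypeIAncientMildClassical
import HarnessLib
import Summits.NavierStokesRegularity.NavierStokesRegularity.Theorems.ScenarioCensusRowF1IntQuenchTop
import Summits.NavierStokesRegularity.NavierStokesRegularity.Theorems.ScenarioCensusRowF1SocketReadout

/-!
# Census row F1, family «stretching / production» — the APEX member F1ia «ALLOWANCE TOP» (floor DA; apex order F1ia ⇒ F1ip / F1ipb) — LINE 24 «allowance-top» port (one file):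
# §10 the ALLOWANCE read-out `allowOf θ`, its calculus, the number `allowanceIntegrand`, the row `Row_F1ia` / `rowF1ia_holds`, the floor `DivergentAllowance`, the residual `IaSlack`
# (≡ `Row_F1`), the dictionary, UNIFICATION in kernel (F1ia ⇒ F1ip / F1ipb / threshold top); census KEYS `Row_F1ia` + `_excluded`, floor DA, edges.  §1–§9 of the line are
# LINES 18/20/22/23/27 VERBATIM and are taken BY NAME from the landed ports (names spelled by namespace; not re-declared)

Re-homed for the scenario census (typer seat ns-census-typer-1 g9; the cell F1ia and the floor DA are MEMBERS OF RECORD «DECIDED IN KERNEL IN FILES» of row F1 since census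
v1.77 (critic backstop idea-crit-7 PASS 02:42Z; ref ns-census-ref g10 PRE-CHECK ✓ §15.16 item 40; lead-presearch label); this port makes them TREE-decided): VERBATIM
PORT of the NEW section (§10) of ns-idea-3 LINE 24 «allowance-top», `pub/ideators/ns-idea-3/lines/allowance-top/line-allowance-top.lean` sha16 9238ae1c674b1f90 (2222 l.,
lean check rc 0, 0 sorry; its §1–§9 are shared VERBATIM with LINES 18/20/22/23 and with LINE 27 §8 and are taken BY NAME from the landed ports — not re-declared),
one tree file (§10 + census KEYS).  Lean text VERBATIM in namespace
`…Theorems.ScenarioCensus.AllowanceTop` (the line's `…Cruxes.ScenarioCensusRowF1.AllowanceTopLine` re-homed) with the shared names spelled by namespace (`LiouvilleSocket.…` for the frame and the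
τ-tool, `IntegratedStretch.…` / `StretchedTop.…` / `FrozenTop.…` / `InviscidTop.…` for the stretching kill and rows); port edits: `@[conjecture]` on the residual `IaSlack` (≡ `ScenarioCensus.Row_F1`, OPEN),
one-line docstrings added where missing (gate lint).  Statements untouched.

No census VALUE is moved here (row F1 stays OPEN-WITH-LINE; the member becomes TREE-decided by name); NS regularity is NOT proved; `Row_F1` is untouched (zero
movement, `iaSlack_iff_rowF1`); no summit statement is proved by this file.
-/

-- the summit and its single problem share the name `NavierStokesRegularity` (D-0017 nested layout)
set_option linter.dupNamespace false

noncomputable section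

open MeasureTheory Set Function Filter TopologicalSpace Metric
open scoped Topology NNReal ENNReal InnerProductSpace RealInnerProductSpace Laplacian

namespace Summit.NavierStokesRegularity.NavierStokesRegularity.Theorems.ScenarioCensus.AllowanceTop

open Literature.Analysis Literature.Analysis.FluidPDE
open Summit.NavierStokesRegularity.NavierStokesRegularity.Theorems

/-! ## §10 The ALLOWANCE rows (NEW in LINE 24): production charged only in excess of the fraction `θ < 1` of the
SELF-SIMILAR RATE `|ω|²/(T − t)` — the read-out `allowOf θ (τ; v, L, H, K) = ⟪curl L, L curl L⟫ − θ ‖curl L‖²/τ`,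
the number `𝓐_θ(u, Λ; t₀) = ∬_{[t₀,T)×ℝ³, |u|>Λ(t)} √(T − t) [⟪ω, Sω⟫ − θ|ω|²/(T − t)]₊`, the row `F1ia`
(PROVED), its floor DIVERGENT ALLOWANCE (PROVED), the residual (≡ `Row_F1`), and the UNIFICATION: `F1ia` implies the
production row `F1ip` (`θ = 0`), the budget row `F1ipb` (`θ = κM²`, Type-I domination of the allowance) and the
eventual threshold rows of LINE 16's type (integrand ≡ 0 near `T`) — all in kernel. -/

/-- **Allowance read-out** (time-dependent, weight 6 jointly with the lag): `⟪curl L, L (curl L)⟫ − θ τ⁻¹ ‖curl L‖²`. -/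
def allowOf (θ τ : ℝ) (_v : LiouvilleSocket.E3) (L : LiouvilleSocket.E3 →L[ℝ] LiouvilleSocket.E3) (_H : LiouvilleSocket.Hess) (_K : LiouvilleSocket.E3 →L[ℝ] LiouvilleSocket.E3) : ℝ :=
  ⟪curlCLM L, L (curlCLM L)⟫ - θ * (τ⁻¹ * ‖curlCLM L‖ ^ 2)

/-- Joint `𝒦`-homogeneity: `allowOf θ (τ; a v, a²L, a³H, a⁴K) = a⁶ · allowOf θ (a²τ; v, L, H, K)` (`a, τ > 0`). -/
theorem allowOf_smul {a τ : ℝ} (ha : 0 < a) (hτ : 0 < τ) (θ : ℝ) (v : LiouvilleSocket.E3) (L : LiouvilleSocket.E3 →L[ℝ] LiouvilleSocket.E3) (H : LiouvilleSocket.Hess)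
    (K : LiouvilleSocket.E3 →L[ℝ] LiouvilleSocket.E3) :
    allowOf θ τ (a • v) (a ^ 2 • L) (a ^ 3 • H) (a ^ 4 • K) = a ^ 6 * allowOf θ (a ^ 2 * τ) v L H K := by
  have ha' : a ≠ 0 := ha.ne'
  have hτ' : τ ≠ 0 := hτ.ne'
  simp only [allowOf, _root_.smul_apply, ContinuousLinearMap.map_smul, smul_smul,
    real_inner_smul_left, real_inner_smul_right, norm_smul, mul_pow, Real.norm_eq_abs, sq_abs, mul_inv]
  field_simp

/-- Continuity of the allowance read-out on `{τ > 0}` (jointly in the lag and the data). -/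
theorem continuousOn_allowOf (θ : ℝ) :
    ContinuousOn (fun q : ℝ × LiouvilleSocket.E3 × (LiouvilleSocket.E3 →L[ℝ] LiouvilleSocket.E3) × LiouvilleSocket.Hess × (LiouvilleSocket.E3 →L[ℝ] LiouvilleSocket.E3) =>
      allowOf θ q.1 q.2.1 q.2.2.1 q.2.2.2.1 q.2.2.2.2) {q | 0 < q.1} := by
  have hc : Continuous (curlCLM : (LiouvilleSocket.E3 →L[ℝ] LiouvilleSocket.E3) →L[ℝ] LiouvilleSocket.E3) := curlCLM.continuous
  have hL : Continuous fun q : ℝ × LiouvilleSocket.E3 × (LiouvilleSocket.E3 →L[ℝ] LiouvilleSocket.E3) × LiouvilleSocket.Hess × (LiouvilleSocket.E3 →L[ℝ] LiouvilleSocket.E3) => curlCLM q.2.2.1 :=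
    hc.comp continuous_snd.snd.fst
  have h3 : Continuous fun q : ℝ × LiouvilleSocket.E3 × (LiouvilleSocket.E3 →L[ℝ] LiouvilleSocket.E3) × LiouvilleSocket.Hess × (LiouvilleSocket.E3 →L[ℝ] LiouvilleSocket.E3) => q.2.2.1 (curlCLM q.2.2.1) :=
    continuous_snd.snd.fst.clm_apply hL
  have hP : Continuous fun q : ℝ × LiouvilleSocket.E3 × (LiouvilleSocket.E3 →L[ℝ] LiouvilleSocket.E3) × LiouvilleSocket.Hess × (LiouvilleSocket.E3 →L[ℝ] LiouvilleSocket.E3) =>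
      ⟪curlCLM q.2.2.1, q.2.2.1 (curlCLM q.2.2.1)⟫ := hL.inner h3
  have hN : Continuous fun q : ℝ × LiouvilleSocket.E3 × (LiouvilleSocket.E3 →L[ℝ] LiouvilleSocket.E3) × LiouvilleSocket.Hess × (LiouvilleSocket.E3 →L[ℝ] LiouvilleSocket.E3) => ‖curlCLM q.2.2.1‖ ^ 2 :=
    hL.norm.pow 2
  have hinv : ContinuousOn (fun q : ℝ × LiouvilleSocket.E3 × (LiouvilleSocket.E3 →L[ℝ] LiouvilleSocket.E3) × LiouvilleSocket.Hess × (LiouvilleSocket.E3 →L[ℝ] LiouvilleSocket.E3) => q.1⁻¹) {q | 0 < q.1} :=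
    continuousOn_fst.inv₀ fun q hq => (ne_of_gt hq)
  exact hP.continuousOn.sub (continuousOn_const.mul (hinv.mul hN.continuousOn))

/-- Continuity in the data at a FIXED lag (any `τ`; Lean's `0⁻¹ = 0`). -/
theorem continuous_allowOf_fixed (θ τ : ℝ) :
    Continuous fun q : LiouvilleSocket.E3 × (LiouvilleSocket.E3 →L[ℝ] LiouvilleSocket.E3) × LiouvilleSocket.Hess × (LiouvilleSocket.E3 →L[ℝ] LiouvilleSocket.E3) => allowOf θ τ q.1 q.2.1 q.2.2.1 q.2.2.2 := by
  have hc : Continuous (curlCLM : (LiouvilleSocket.E3 →L[ℝ] LiouvilleSocket.E3) →L[ℝ] LiouvilleSocket.E3) := curlCLM.continuous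
  have hL : Continuous fun q : LiouvilleSocket.E3 × (LiouvilleSocket.E3 →L[ℝ] LiouvilleSocket.E3) × LiouvilleSocket.Hess × (LiouvilleSocket.E3 →L[ℝ] LiouvilleSocket.E3) => curlCLM q.2.1 :=
    hc.comp continuous_snd.fst
  have h3 : Continuous fun q : LiouvilleSocket.E3 × (LiouvilleSocket.E3 →L[ℝ] LiouvilleSocket.E3) × LiouvilleSocket.Hess × (LiouvilleSocket.E3 →L[ℝ] LiouvilleSocket.E3) => q.2.1 (curlCLM q.2.1) :=
    continuous_snd.fst.clm_apply hL
  exact (hL.inner h3).sub (continuous_const.mul (continuous_const.mul (hL.norm.pow 2)))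

/-- `allowOf` vanishes at the zero datum. -/
theorem allowOf_zero (θ τ : ℝ) : allowOf θ τ 0 0 0 0 = 0 := by simp [allowOf]

/-- The allowance read-out of `(v, ∇v, ∇²v, K)(x)` at lag `τ` is `⟪ω, (ω·∇)v⟫ − θ τ⁻¹ |ω|²` at `x`. -/
theorem allow_eq (θ τ : ℝ) (v : LiouvilleSocket.E3 → LiouvilleSocket.E3) (x : LiouvilleSocket.E3) :
    ⟪curl v x, convect (curl v) v x⟫ - θ * (τ⁻¹ * ‖curl v x‖ ^ 2) =
      allowOf θ τ (v x) (fderiv ℝ v x) (fderiv ℝ (fderiv ℝ v) x) (LiouvilleSocket.lapD v x) := by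
  rw [allowOf, FrozenTop.convect_curl_self, IntegratedStretch.curl_apply_eq]

/-- `ν`-normalisation: `ν³ · allowOf θ (νσ; u/ν, ∇u/ν, ∇²u/ν, K/ν) = ⟪ω, (ω·∇)u⟫ − θ σ⁻¹ |ω|²` (`ν, σ > 0`). -/
theorem nu_readout_allowOf {ν σ : ℝ} (hν : 0 < ν) (hσ : 0 < σ) (θ : ℝ) (v : LiouvilleSocket.E3 → LiouvilleSocket.E3) (x : LiouvilleSocket.E3) :
    ν ^ 3 * allowOf θ (ν * σ) (ν⁻¹ • v x) (ν⁻¹ • fderiv ℝ v x) (ν⁻¹ • fderiv ℝ (fderiv ℝ v) x)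
      (ν⁻¹ • LiouvilleSocket.lapD v x) = ⟪curl v x, convect (curl v) v x⟫ - θ * (σ⁻¹ * ‖curl v x‖ ^ 2) := by
  have hν' : ν ≠ 0 := hν.ne'
  have hσ' : σ ≠ 0 := hσ.ne'
  rw [FrozenTop.convect_curl_self, IntegratedStretch.curl_apply_eq]
  simp only [allowOf, _root_.smul_apply, ContinuousLinearMap.map_smul, smul_smul,
    real_inner_smul_left, real_inner_smul_right, norm_smul, mul_pow, Real.norm_eq_abs, sq_abs, mul_inv]
  field_simp

/-- The number of the line — the **ALLOWANCE (EXCESS-PRODUCTION) INTEGRAND OF THE FAST FLUID** on `[t₀, T)`: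
`𝟙{t ∈ [t₀,T), Λ(t) < |u(t,x)|} · √(T − t) · max(0, ⟪ω, (ω·∇)u⟫ − θ |ω|²/(T − t))` — production is charged only in
EXCESS of the fraction `θ` of the self-similar rate `|ω|²/(T − t)`; ONE-SIDED; KINEMATIC (no pressure, no viscosity,
no time derivative); `θ = 0`, `t₀ = 0` is the production integrand of LINE 23. -/
def allowanceIntegrand (T θ t₀ : ℝ) (Λ : ℝ → ℝ) (u : ℝ → LiouvilleSocket.E3 → LiouvilleSocket.E3) : ℝ × LiouvilleSocket.E3 → ℝ≥0∞ :=
  {z : ℝ × LiouvilleSocket.E3 | z.1 ∈ Ico t₀ T ∧ Λ z.1 < ‖u z.1 z.2‖}.indicator fun z =>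
    ENNReal.ofReal (Real.sqrt (T - z.1) *
      max 0 (⟪curl (u z.1) z.2, convect (curl (u z.1)) (u z.1) z.2⟫ - θ * ((T - z.1)⁻¹ * ‖curl (u z.1) z.2‖ ^ 2)))

/-- **Criterion row F1ia** (the exact frame of `Row_F1` plus ONE hypothesis: for some `θ < 1`, some `t₀ ∈ [0, T)` and
some MEASURABLE subcritical level, the excess production of the fast fluid over `θ|ω|²/(T − t)` is integrable against
`√(T − t)` on `[t₀, T) × ℝ³`).  PROVED (`rowF1ia_holds`). -/
def Row_F1ia : Prop :=
  ∀ (ν T : ℝ), 0 < ν → 0 < T → ∀ (u : ℝ → LiouvilleSocket.E3 → LiouvilleSocket.E3) (p : ℝ → LiouvilleSocket.E3 → ℝ),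
    IsClassicalNSSolutionOn (Ico 0 T) ν 0 u p → IsLerayHopfOn T ν 0 (u 0) u →
    HasRapidSpatialDecay (u 0) → IsTypeIBlowup u T →
    (∃ (θ t₀ : ℝ) (Λ : ℝ → ℝ), θ < 1 ∧ 0 ≤ t₀ ∧ t₀ < T ∧ LiouvilleSocket.IsSubcriticalLevel T Λ ∧ Measurable Λ ∧
      ∫⁻ z, allowanceIntegrand T θ t₀ Λ u z < ⊤) →
    HasSmoothExtensionPast ν 0 u T

/-- **DIVERGENT ALLOWANCE** (structural floor, maximal frame): for a maximal Type-I Clay blow-up, EVERY `θ < 1`,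
every `t₀ ∈ [0, T)` and every measurable subcritical level,
`∬_{[t₀,T), |u| > Λ(t)} √(T − t) [⟪ω, Sω⟫ − θ|ω|²/(T − t)]₊ dx dt = ∞`.  PROVED (`divergentAllowance_holds`). -/
def DivergentAllowance : Prop :=
  ∀ (ν T : ℝ), 0 < ν → 0 < T → ∀ (u : ℝ → LiouvilleSocket.E3 → LiouvilleSocket.E3) (p : ℝ → LiouvilleSocket.E3 → ℝ),
    IsMaximalSmoothSolution ν 0 u p T → IsLerayHopfOn T ν 0 (u 0) u →
    HasRapidSpatialDecay (u 0) → IsTypeIBlowup u T →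
    ∀ θ : ℝ, θ < 1 → ∀ t₀ : ℝ, 0 ≤ t₀ → t₀ < T →
    ∀ Λ : ℝ → ℝ, LiouvilleSocket.IsSubcriticalLevel T Λ → Measurable Λ → ∫⁻ z, allowanceIntegrand T θ t₀ Λ u z = ⊤

/-- **Residual** (maximal frame): every maximal Type-I Clay blow-up has, for some `θ < 1`, `t₀ ∈ [0,T)` and measurable
subcritical level, an integrable excess production.  DECLARED ≡ row F1 (`iaSlack_iff_rowF1`). -/
@[conjecture] def IaSlack : Prop :=
  ∀ (ν T : ℝ), 0 < ν → 0 < T → ∀ (u : ℝ → LiouvilleSocket.E3 → LiouvilleSocket.E3) (p : ℝ → LiouvilleSocket.E3 → ℝ),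
    IsMaximalSmoothSolution ν 0 u p T → IsLerayHopfOn T ν 0 (u 0) u →
    HasRapidSpatialDecay (u 0) → IsTypeIBlowup u T →
    ∃ (θ t₀ : ℝ) (Λ : ℝ → ℝ), θ < 1 ∧ 0 ≤ t₀ ∧ t₀ < T ∧ LiouvilleSocket.IsSubcriticalLevel T Λ ∧ Measurable Λ ∧
      ∫⁻ z, allowanceIntegrand T θ t₀ Λ u z < ⊤

/-- **The split**: criterion + residual ⇒ row F1. -/
theorem rowF1_of_ia (hD : Row_F1ia) (hR : IaSlack) : ScenarioCensus.Row_F1 := by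
  unfold ScenarioCensus.Row_F1
  intro ν T hν hT u p hsol hLH hdec hTI
  by_contra hext
  exact hext (hD ν T hν hT u p hsol hLH hdec hTI (hR ν T hν hT u p ⟨hsol, hext⟩ hLH hdec hTI))

/-- Row F1 ⇒ the residual (vacuously: no maximal Type-I Clay blow-up). -/
theorem iaSlack_of_rowF1 (h : ScenarioCensus.Row_F1) : IaSlack :=
  fun ν T hν hT u p hmax hLH hdec hTI => (hmax.2 (h ν T hν hT u p hmax.1 hLH hdec hTI)).elim

/-! ### Dictionary: the number = `ν^{5/2} ×` the normalised `[t₀,T)`-top integrand of the read-out `allowOf θ` -/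

/-- `LiouvilleSocket.topIntegrandτ(allowOf θ) = ofReal(√ν · ν⁻³) · allowanceIntegrand` pointwise (kinematics). -/
theorem topIntegrandτ_allowOf_eq {ν : ℝ} (hν : 0 < ν) (T θ t₀ : ℝ) (Λ : ℝ → ℝ) (u : ℝ → LiouvilleSocket.E3 → LiouvilleSocket.E3)
    (z : ℝ × LiouvilleSocket.E3) :
    LiouvilleSocket.topIntegrandτ T ν t₀ Λ (fun τ v L H K => allowOf θ τ v L H K) u z =
      ENNReal.ofReal (Real.sqrt ν * (ν ^ 3)⁻¹) * allowanceIntegrand T θ t₀ Λ u z := by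
  by_cases hz : z ∈ {z : ℝ × LiouvilleSocket.E3 | z.1 ∈ Ico t₀ T ∧ Λ z.1 < ‖u z.1 z.2‖}
  · have hσ : 0 < T - z.1 := sub_pos.2 hz.1.2
    rw [LiouvilleSocket.topIntegrandτ, allowanceIntegrand, indicator_of_mem hz, indicator_of_mem hz,
      ← ENNReal.ofReal_mul (mul_nonneg (Real.sqrt_nonneg ν) (inv_nonneg.2 (pow_nonneg hν.le 3)))]
    congr 1
    have key := nu_readout_allowOf hν hσ θ (u z.1) z.2
    have hν3 : ν ^ 3 ≠ 0 := by positivity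
    have hI : allowOf θ (ν * (T - z.1)) (ν⁻¹ • u z.1 z.2) (ν⁻¹ • fderiv ℝ (u z.1) z.2)
        (ν⁻¹ • fderiv ℝ (fderiv ℝ (u z.1)) z.2) (ν⁻¹ • LiouvilleSocket.lapD (u z.1) z.2) =
        (ν ^ 3)⁻¹ * (⟪curl (u z.1) z.2, convect (curl (u z.1)) (u z.1) z.2⟫
          - θ * ((T - z.1)⁻¹ * ‖curl (u z.1) z.2‖ ^ 2)) := by
      rw [eq_inv_mul_iff_mul_eq₀ hν3]
      exact key
    have hmax : ∀ P : ℝ, max 0 ((ν ^ 3)⁻¹ * P) = (ν ^ 3)⁻¹ * max 0 P := fun P => by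
      rw [mul_max_of_nonneg _ _ (inv_nonneg.2 (pow_nonneg hν.le 3)), mul_zero]
    rw [hI, Real.sqrt_mul hν.le, hmax]
    ring
  · rw [LiouvilleSocket.topIntegrandτ, allowanceIntegrand, indicator_of_notMem hz, indicator_of_notMem hz, mul_zero]

/-- `∫ LiouvilleSocket.topIntegrandτ(allowOf θ) = ν^{-5/2} ∫ allowanceIntegrand`. -/
theorem lintegral_topIntegrandτ_allowOf_eq {ν : ℝ} (hν : 0 < ν) (T θ t₀ : ℝ) (Λ : ℝ → ℝ)
    (u : ℝ → LiouvilleSocket.E3 → LiouvilleSocket.E3) :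
    ∫⁻ z, LiouvilleSocket.topIntegrandτ T ν t₀ Λ (fun τ v L H K => allowOf θ τ v L H K) u z =
      ENNReal.ofReal (Real.sqrt ν * (ν ^ 3)⁻¹) * ∫⁻ z, allowanceIntegrand T θ t₀ Λ u z := by
  rw [← lintegral_const_mul' _ _ ENNReal.ofReal_ne_top]
  exact lintegral_congr fun z => topIntegrandτ_allowOf_eq hν T θ t₀ Λ u z

/-! ### The row is EXCLUDED; the floor; the residual ≡ `Row_F1` -/

/-- **Criterion row F1ia is EXCLUDED** (in kernel).  Engine: singular zoom at a non-extendable point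
(`FrozenTop.exists_singularZoom_package₃`) → the time-dependent INTEGRAL TRANSFER `LiouvilleSocket.integral_transfer₆τ` gives
`⟪ω̃, ∇W ω̃⟫ − θ|ω̃|²/(−s) ≤ 0` wherever `W ≠ 0` → analytic globalisation (`FrozenTop.jointCond_everywhere₄`, lag-dependent
condition) → `(−s)⟪∇W ω̃, ω̃⟫ ≤ θ|ω̃|²` EVERYWHERE on the open past: EXACTLY the hypothesis of the tree's
stretching-certificate Liouville theorem (`StretchedTop.typeI_ancient_eq_zero_of_subcriticalStretching`, `θ < 1`) → `W ≡ 0`,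
contradicting non-triviality of the zoom limit. -/
theorem rowF1ia_holds : Row_F1ia := by
  intro ν T hν hT u p hsol hLH hdec hTI htop
  obtain ⟨θ, t₀, Λ, hθ, ht₀, ht₀T, hΛ, hΛm, hfinP⟩ := htop
  obtain ⟨M, hM⟩ := LiouvilleSocket.exists_isTypeIBlowupWith hν hTI
  have hfin : ∫⁻ z, LiouvilleSocket.topIntegrandτ T ν t₀ Λ (fun τ v L H K => allowOf θ τ v L H K) u z < ⊤ := by
    rw [lintegral_topIntegrandτ_allowOf_eq hν T θ t₀ Λ u]
    exact ENNReal.mul_lt_top ENNReal.ofReal_lt_top hfinP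
  apply hasSmoothExtensionPast_of_forall_exists_parabolicCylinder hν hT hsol hLH hdec
  intro x₀
  by_contra hno
  obtain ⟨α, β, R, c, W, hα, hβ, hR, hαR, hαν, hcpos, hclim, hW, hpt, hgrad, hhess, hlap, t, ht, y, hne⟩ :=
    FrozenTop.exists_singularZoom_package₃ hν hT hsol hLH hdec hM x₀ (InviscidTop.sing_of_not_bounded hno)
  have hRd := LiouvilleSocket.integral_transfer₆τ hν hsol hW ht₀ ht₀T hα hβ hαR hαν hcpos hclim hpt hgrad hhess hlap
    (Rd := fun τ v L H K => allowOf θ τ v L H K) (continuousOn_allowOf θ)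
    (fun a ha τ hτ v L H K => allowOf_smul ha hτ θ v L H K) hΛ hΛm hfin
  have hall := FrozenTop.jointCond_everywhere₄ hW (P := fun w q => allowOf θ (-w) q.1 q.2.1 q.2.2.1 q.2.2.2 ≤ 0)
    (fun w => isClosed_le (continuous_allowOf_fixed θ (-w)) continuous_const)
    (fun w => by show allowOf θ (-w) 0 0 0 0 ≤ 0; rw [allowOf_zero]) hRd
  refine hne (StretchedTop.typeI_ancient_eq_zero_of_subcriticalStretching hθ hW (fun s hs y' => ?_) t ht y)
  have hb : ⟪curl (W s) y', convect (curl (W s)) (W s) y'⟫ - θ * ((-s)⁻¹ * ‖curl (W s) y'‖ ^ 2) ≤ 0 := by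
    rw [allow_eq]
    exact hall s hs y'
  have hcomm : ⟪fderiv ℝ (W s) y' (curl (W s) y'), curl (W s) y'⟫ =
      ⟪curl (W s) y', convect (curl (W s)) (W s) y'⟫ := by
    rw [IntegratedStretch.stretch_eq', ← IntegratedStretch.stretch_eq]
  have hs0 : 0 < -s := neg_pos.2 hs
  have hsne : (-s) ≠ 0 := hs0.ne'
  rw [hcomm]
  have h1 : (-s) * ⟪curl (W s) y', convect (curl (W s)) (W s) y'⟫ ≤
      (-s) * (θ * ((-s)⁻¹ * ‖curl (W s) y'‖ ^ 2)) :=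
    mul_le_mul_of_nonneg_left (by linarith) hs0.le
  have h2 : (-s) * (θ * ((-s)⁻¹ * ‖curl (W s) y'‖ ^ 2)) = θ * ‖curl (W s) y'‖ ^ 2 := by
    calc (-s) * (θ * ((-s)⁻¹ * ‖curl (W s) y'‖ ^ 2))
        = θ * ‖curl (W s) y'‖ ^ 2 * ((-s) * (-s)⁻¹) := by ring
      _ = θ * ‖curl (W s) y'‖ ^ 2 := by rw [mul_inv_cancel₀ hsne, mul_one]
  exact h1.trans_eq h2

/-- **The floor DIVERGENT ALLOWANCE holds.** -/
theorem divergentAllowance_holds : DivergentAllowance := by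
  intro ν T hν hT u p hmax hLH hdec hTI θ hθ t₀ ht₀ ht₀T Λ hΛ hΛm
  by_contra hne
  exact hmax.2 (rowF1ia_holds ν T hν hT u p hmax.1 hLH hdec hTI
    ⟨θ, t₀, Λ, hθ, ht₀, ht₀T, hΛ, hΛm, lt_top_iff_ne_top.2 hne⟩)

/-- The residual is EXACTLY row F1 (declared; no movement on `Row_F1` is claimed). -/
theorem iaSlack_iff_rowF1 : IaSlack ↔ ScenarioCensus.Row_F1 :=
  ⟨fun h => rowF1_of_ia rowF1ia_holds h, iaSlack_of_rowF1⟩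

/-- Row F1 from the residual alone (the criterion being proved). -/
theorem rowF1_of_iaSlack (h : IaSlack) : ScenarioCensus.Row_F1 := rowF1_of_ia rowF1ia_holds h

/-! ### UNIFICATION (in kernel): the allowance row implies the production row (`θ = 0`), the budget row
(`θ = κM²`) and the eventual threshold rows -/

/-- `θ = 0`, `t₀ = 0`: the allowance integrand IS the production integrand. -/
theorem allowanceIntegrand_zero_eq (T : ℝ) (Λ : ℝ → ℝ) (u : ℝ → LiouvilleSocket.E3 → LiouvilleSocket.E3) (z : ℝ × LiouvilleSocket.E3) :
    allowanceIntegrand T 0 0 Λ u z = IntegratedStretch.productionIntegrand T Λ u z := by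
  by_cases hz : z ∈ {z : ℝ × LiouvilleSocket.E3 | z.1 ∈ Ico 0 T ∧ Λ z.1 < ‖u z.1 z.2‖}
  · rw [allowanceIntegrand, IntegratedStretch.productionIntegrand, indicator_of_mem hz, indicator_of_mem hz, zero_mul, sub_zero]
  · rw [allowanceIntegrand, IntegratedStretch.productionIntegrand, indicator_of_notMem hz, indicator_of_notMem hz]

/-- **F1ia ⇒ F1ip** (the production row is the case `θ = 0`, `t₀ = 0`). -/
theorem rowF1ip_of_rowF1ia (h : Row_F1ia) : IntegratedStretch.Row_F1ip := by
  intro ν T hν hT u p hsol hLH hdec hTI htop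
  obtain ⟨Λ, hΛ, hΛm, hfinP⟩ := htop
  refine h ν T hν hT u p hsol hLH hdec hTI ⟨0, 0, Λ, zero_lt_one, le_rfl, hT, hΛ, hΛm, ?_⟩
  rw [lintegral_congr (allowanceIntegrand_zero_eq T Λ u)]
  exact hfinP

/-- **Type I DOMINATES the budget allowance by the self-similar allowance**: on `[t₀, T)` inside the Type-I(`M`) window,
`[P − κM² |ω|²/(T − t)]₊ ≤ [P − κ |u|²|ω|²/ν]₊` pointwise (`κ ≥ 0`; `(T − t)|u|² ≤ M²ν`). -/
theorem allowance_le_budget {T ν M κ t₀ : ℝ} (hν : 0 < ν) (hκ : 0 ≤ κ) {u : ℝ → LiouvilleSocket.E3 → LiouvilleSocket.E3} {Λ : ℝ → ℝ}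
    (ht₀ : 0 ≤ t₀) (hTI : ∀ t ∈ Ico t₀ T, ∀ x : LiouvilleSocket.E3, Real.sqrt (T - t) * ‖u t x‖ ≤ M * Real.sqrt ν)
    (z : ℝ × LiouvilleSocket.E3) : allowanceIntegrand T (κ * M ^ 2) t₀ Λ u z ≤ IntegratedStretch.budgetIntegrand T ν κ Λ u z := by
  by_cases hz : z ∈ {z : ℝ × LiouvilleSocket.E3 | z.1 ∈ Ico t₀ T ∧ Λ z.1 < ‖u z.1 z.2‖}
  · have hz' : z ∈ {z : ℝ × LiouvilleSocket.E3 | z.1 ∈ Ico 0 T ∧ Λ z.1 < ‖u z.1 z.2‖} :=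
      ⟨⟨ht₀.trans hz.1.1, hz.1.2⟩, hz.2⟩
    rw [allowanceIntegrand, IntegratedStretch.budgetIntegrand, indicator_of_mem hz, indicator_of_mem hz']
    refine ENNReal.ofReal_le_ofReal (mul_le_mul_of_nonneg_left (max_le_max le_rfl ?_) (Real.sqrt_nonneg _))
    have hσ : 0 < T - z.1 := sub_pos.2 hz.1.2
    have hb := hTI z.1 hz.1 z.2
    have h0 : 0 ≤ Real.sqrt (T - z.1) * ‖u z.1 z.2‖ := mul_nonneg (Real.sqrt_nonneg _) (norm_nonneg _)
    have h2 := pow_le_pow_left₀ h0 hb 2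
    rw [mul_pow, mul_pow, Real.sq_sqrt hσ.le, Real.sq_sqrt hν.le] at h2
    -- h2 : (T − t)|u|² ≤ M² ν
    have h3 : ν⁻¹ * ‖u z.1 z.2‖ ^ 2 ≤ M ^ 2 * (T - z.1)⁻¹ := by
      rw [inv_mul_le_iff₀ hν, show ν * (M ^ 2 * (T - z.1)⁻¹) = ν * M ^ 2 / (T - z.1) by ring,
        le_div_iff₀ hσ]
      linarith
    have hN : 0 ≤ ‖curl (u z.1) z.2‖ ^ 2 := sq_nonneg _
    have h4 : κ * (ν⁻¹ * ‖u z.1 z.2‖ ^ 2 * ‖curl (u z.1) z.2‖ ^ 2) ≤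
        κ * M ^ 2 * ((T - z.1)⁻¹ * ‖curl (u z.1) z.2‖ ^ 2) := by
      have h5 := mul_le_mul_of_nonneg_right h3 hN
      have h6 := mul_le_mul_of_nonneg_left h5 hκ
      calc κ * (ν⁻¹ * ‖u z.1 z.2‖ ^ 2 * ‖curl (u z.1) z.2‖ ^ 2)
          ≤ κ * (M ^ 2 * (T - z.1)⁻¹ * ‖curl (u z.1) z.2‖ ^ 2) := h6
        _ = κ * M ^ 2 * ((T - z.1)⁻¹ * ‖curl (u z.1) z.2‖ ^ 2) := by ring
    linarith
  · rw [allowanceIntegrand, indicator_of_notMem hz]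
    exact bot_le

/-- **F1ia ⇒ F1ipb** (the budget row is the case `θ = κM²` on the Type-I window `[t₀, T)`). -/
theorem rowF1ipb_of_rowF1ia (h : Row_F1ia) : IntegratedStretch.Row_F1ipb := by
  intro ν T hν hT u p hsol hLH hdec hTI htop
  obtain ⟨M, κ, Λ, hM, hκ, hθ, hΛ, hΛm, hfinP⟩ := htop
  obtain ⟨t₁, ht₁T, hsub⟩ := (mem_nhdsLT_iff_exists_Ioo_subset).1 hM
  have ht₁T' : t₁ < T := ht₁T
  set t₀ : ℝ := max 0 ((t₁ + T) / 2) with ht₀def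
  have ht₀ : 0 ≤ t₀ := le_max_left _ _
  have ht₀T : t₀ < T := max_lt hT (by linarith)
  have hTI' : ∀ t ∈ Ico t₀ T, ∀ x : LiouvilleSocket.E3, Real.sqrt (T - t) * ‖u t x‖ ≤ M * Real.sqrt ν := by
    intro t ht' x
    have ht1 : t₁ < t := by
      have : (t₁ + T) / 2 ≤ t := (le_max_right _ _).trans ht'.1
      linarith
    have hmem : t ∈ {t : ℝ | ∀ x : LiouvilleSocket.E3, Real.sqrt (T - t) * ‖u t x‖ ≤ M * Real.sqrt ν} := hsub ⟨ht1, ht'.2⟩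
    exact hmem x
  refine h ν T hν hT u p hsol hLH hdec hTI ⟨κ * M ^ 2, t₀, Λ, hθ, ht₀, ht₀T, hΛ, hΛm, ?_⟩
  exact lt_of_le_of_lt (lintegral_mono fun z => allowance_le_budget hν hκ ht₀ hTI' z) hfinP

/-- **F1ia CONTAINS the eventual threshold rows** (LINE 16's type, stated in the production convention): Type I + for
some `θ < 1` and some measurable subcritical level, EVENTUALLY `(T − t)⟪ω, Sω⟫ ≤ θ|ω|²` at every fast point ⇒ smooth
extension — the allowance integrand then vanishes identically on `[t₀, T)` for `t₀` inside the window. -/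
theorem rowF1_thresholdTop_of_rowF1ia (h : Row_F1ia) : ∀ (ν T : ℝ), 0 < ν → 0 < T →
    ∀ (u : ℝ → LiouvilleSocket.E3 → LiouvilleSocket.E3) (p : ℝ → LiouvilleSocket.E3 → ℝ),
    IsClassicalNSSolutionOn (Ico 0 T) ν 0 u p → IsLerayHopfOn T ν 0 (u 0) u →
    HasRapidSpatialDecay (u 0) → IsTypeIBlowup u T →
    (∃ (θ : ℝ) (Λ : ℝ → ℝ), θ < 1 ∧ LiouvilleSocket.IsSubcriticalLevel T Λ ∧ Measurable Λ ∧
      ∀ᶠ t in 𝓝[<] T, ∀ x : LiouvilleSocket.E3, Λ t < ‖u t x‖ →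
        (T - t) * ⟪curl (u t) x, convect (curl (u t)) (u t) x⟫ ≤ θ * ‖curl (u t) x‖ ^ 2) →
    HasSmoothExtensionPast ν 0 u T := by
  intro ν T hν hT u p hsol hLH hdec hTI htop
  obtain ⟨θ, Λ, hθ, hΛ, hΛm, hev⟩ := htop
  obtain ⟨t₁, ht₁T, hsub⟩ := (mem_nhdsLT_iff_exists_Ioo_subset).1 hev
  have ht₁T' : t₁ < T := ht₁T
  set t₀ : ℝ := max 0 ((t₁ + T) / 2) with ht₀def
  have ht₀ : 0 ≤ t₀ := le_max_left _ _
  have ht₀T : t₀ < T := max_lt hT (by linarith)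
  have hzero : ∀ z, allowanceIntegrand T θ t₀ Λ u z = 0 := by
    intro z
    by_cases hz : z ∈ {z : ℝ × LiouvilleSocket.E3 | z.1 ∈ Ico t₀ T ∧ Λ z.1 < ‖u z.1 z.2‖}
    · rw [allowanceIntegrand, indicator_of_mem hz]
      have hσ : 0 < T - z.1 := sub_pos.2 hz.1.2
      have ht1 : t₁ < z.1 := by
        have : (t₁ + T) / 2 ≤ z.1 := (le_max_right _ _).trans hz.1.1
        linarith
      have hmem : z.1 ∈ {t : ℝ | ∀ x : LiouvilleSocket.E3, Λ t < ‖u t x‖ →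
          (T - t) * ⟪curl (u t) x, convect (curl (u t)) (u t) x⟫ ≤ θ * ‖curl (u t) x‖ ^ 2} :=
        hsub ⟨ht1, hz.1.2⟩
      have hP : (T - z.1) * ⟪curl (u z.1) z.2, convect (curl (u z.1)) (u z.1) z.2⟫ ≤
          θ * ‖curl (u z.1) z.2‖ ^ 2 := hmem z.2 hz.2
      have hle : ⟪curl (u z.1) z.2, convect (curl (u z.1)) (u z.1) z.2⟫
          - θ * ((T - z.1)⁻¹ * ‖curl (u z.1) z.2‖ ^ 2) ≤ 0 := by
        have h1 : ⟪curl (u z.1) z.2, convect (curl (u z.1)) (u z.1) z.2⟫ ≤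
            θ * ‖curl (u z.1) z.2‖ ^ 2 / (T - z.1) := by
          rw [le_div_iff₀ hσ]
          linarith
        have e : θ * ((T - z.1)⁻¹ * ‖curl (u z.1) z.2‖ ^ 2) = θ * ‖curl (u z.1) z.2‖ ^ 2 / (T - z.1) := by
          ring
        linarith
      rw [max_eq_left hle, mul_zero, ENNReal.ofReal_zero]
    · rw [allowanceIntegrand, indicator_of_notMem hz]
  refine h ν T hν hT u p hsol hLH hdec hTI ⟨θ, t₀, Λ, hθ, ht₀, ht₀T, hΛ, hΛm, ?_⟩
  rw [lintegral_congr hzero, lintegral_zero]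
  exact lt_top_iff_ne_top.2 ENNReal.zero_ne_top

end Summit.NavierStokesRegularity.NavierStokesRegularity.Theorems.ScenarioCensus.AllowanceTop

namespace Summit.NavierStokesRegularity.NavierStokesRegularity.Theorems.ScenarioCensus

/-! ## Census KEYS (ns `…Theorems.ScenarioCensus`): the ALLOWANCE-TOP member of row F1 (LINE 24) — TREE-decided F1ia, floor DA, apex edges F1ia ⇒ F1ip / F1ipb -/

/-- **Cell F1ia «ALLOWANCE TOP»** (row F1 frame VERBATIM + for some `θ < 1`, `t₀ ∈ [0,T)` and a measurable subcritical level, the excess production of the fast fluid over `θ|ω|²/(T−t)` is integrable against `√(T−t)` on `[t₀,T) × ℝ³` ⇒ smooth extension past `T`): `:= AllowanceTop.Row_F1ia`. DECIDED. -/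
def Row_F1ia : Prop := AllowanceTop.Row_F1ia
/-- F1ia is EXCLUDED (decided in the tree): `AllowanceTop.rowF1ia_holds`. -/
theorem row_F1ia_excluded : Row_F1ia := AllowanceTop.rowF1ia_holds

/-- **Floor DA — DIVERGENT ALLOWANCE**: `AllowanceTop.divergentAllowance_holds`. -/
theorem row_F1_divergentAllowance : AllowanceTop.DivergentAllowance := AllowanceTop.divergentAllowance_holds
/-- Apex edges at key level: F1ia ⇒ F1ip, F1ia ⇒ F1ipb (`AllowanceTop.rowF1ip_of_rowF1ia` / `rowF1ipb_of_rowF1ia`). -/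
theorem rowF1ip_of_rowF1ia : Row_F1ia → Row_F1ip := AllowanceTop.rowF1ip_of_rowF1ia
/-- See `rowF1ip_of_rowF1ia`. -/
theorem rowF1ipb_of_rowF1ia : Row_F1ia → Row_F1ipb := AllowanceTop.rowF1ipb_of_rowF1ia

end Summit.NavierStokesRegularity.NavierStokesRegularity.Theorems.ScenarioCensus

end
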